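import Mathlib
import Literature.Analysis.FluidPDE.TypeIICoreWitness
import Literature.Analysis.FluidPDE.SuitableWeak
import Summits.NavierStokesRegularity.NavierStokesRegularity.Theorems.TypeIIInviscidRelaxationCoreExclusionAnchorObstruction
import HarnessLib

/-!
# Crux `ColumnarCoreExclusion` (stmt-1966): even LATE witnesses at every level do not give a core-radius floor or
# anchoring — the floor hypothesis of the anchor reduction is independently necessary

`--supports stmt-NavierStokesRegularity-1966` (helper file, negative side; theorems only, no definitions, no `sorry`).
Third certificate of the series `…CoreExclusionAnchorObstruction` (p832090: `hw` ⇏ lateness/floor),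
`…AnchorObstructionWandering` (p832578: `hw` ⇏ anchoring).  The reduction
`CoreExclusionAnchor.anchoredLateWitness_of_lateWitnesses_radiusFloor` (p831087) derives the anchor stub from LATE
witnesses WITH A CORE-RADIUS FLOOR.  Here (`exists_lateColumnarWitnesses_unfloored_unanchored`) an explicit kinematic
family carries LATE columnar witnesses at EVERY level frequently before `T = 1` (so lateness is granted), has the
origin as its unique singular point, grows faster than the Type-I rate — and yet every level-`K` columnar datum
(`K > 4`, `0 < t < 1`) has core radius `K·L < 3(1-t)^{1/4} → 0` (no floor) and is not anchored at the singular point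
(`dist 0 x₀ > K·L/4`).  The family lives in the INTERMEDIATE-RATE regime `(1-t)^{-1/2} ≪ ‖u(t)‖_∞ = (1-t)^{-3/4} ≪
(1-t)^{-1}`: the core (length `(1-t)^{1/4}/K` at level `K`, cut off at radius `(1-t)^{1/4}`) is centred at
`3(1-t)^{1/4}·e_x → 0`.  Complement (`radiusFloor_of_late_of_rate`, one line): at the EULER rate
`(T-t)·V ≥ r₀` lateness alone gives the floor `K·L ≥ r₀`.  So the floor in p831087 is exactly the price of the
intermediate regime.  Nothing about Navier–Stokes is claimed; `u` is not a solution; no stub or crux is proved or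
refuted here.
-/

noncomputable section

open Set Metric Filter Topology
open Literature.Analysis Literature.Analysis.FluidPDE

namespace Summit.NavierStokesRegularity.NavierStokesRegularity.Theorems

-- the problem directory repeats the summit name (`NavierStokesRegularity/NavierStokesRegularity`)
set_option linter.dupNamespace false

namespace CoreExclusionAnchorObstruction

/-- `‖e_z‖ = 1` (file-local copy). [folklore] -/
private theorem norm_eZ_l : ‖(eZ : EuclideanSpace ℝ (Fin 3))‖ = 1 := by
  simp [eZ]

/-- **At the Euler rate, lateness gives the floor for free**: if `(T-t)·V ≥ r₀` (speed at least `r₀/(T-t)`) and the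
witness is late, `(T-t)·V ≤ K·L`, then `K·L ≥ r₀`.  (One line; recorded to mark the regime in which the floor
hypothesis of `CoreExclusionAnchor.anchoredLateWitness_of_lateWitnesses_radiusFloor` is automatic.) [folklore] -/
theorem radiusFloor_of_late_of_rate {T t V K L r₀ : ℝ} (hrate : r₀ ≤ (T - t) * V) (hlate : (T - t) * V ≤ K * L) :
    r₀ ≤ K * L :=
  hrate.trans hlate

/-- The fourth root `σ = (1-t)^{1/4}` as an iterated square root: positivity and `σ⁴ = 1 - t`. [folklore] -/
theorem sqrt_sqrt_pos_and_pow_four {t : ℝ} (ht : t < 1) :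
    0 < Real.sqrt (Real.sqrt (1 - t)) ∧ Real.sqrt (Real.sqrt (1 - t)) ^ 2 = Real.sqrt (1 - t) ∧
      Real.sqrt (Real.sqrt (1 - t)) ^ 4 = 1 - t := by
  have hs : 0 < 1 - t := sub_pos.2 ht
  have h2 : Real.sqrt (Real.sqrt (1 - t)) ^ 2 = Real.sqrt (1 - t) := Real.sq_sqrt (Real.sqrt_nonneg _)
  refine ⟨Real.sqrt_pos.2 (Real.sqrt_pos.2 hs), h2, ?_⟩
  calc Real.sqrt (Real.sqrt (1 - t)) ^ 4 = (Real.sqrt (Real.sqrt (1 - t)) ^ 2) ^ 2 := by ring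
    _ = 1 - t := by rw [h2, Real.sq_sqrt hs.le]

/-- `(1 - (1 - a⁴))^{1/4} = a` for `a ≥ 0`. [folklore] -/
theorem sqrt_sqrt_one_sub (a : ℝ) (ha : 0 ≤ a) : Real.sqrt (Real.sqrt (1 - (1 - a ^ 4))) = a := by
  rw [sub_sub_cancel, show a ^ 4 = (a ^ 2) ^ 2 by ring, Real.sqrt_sq (sq_nonneg a), Real.sqrt_sq ha]

/-- **Late columnar witnesses at every level, yet no floor and no anchoring** (kinematic; see the module docstring).
[folklore] -/
theorem exists_lateColumnarWitnesses_unfloored_unanchored :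
    ∃ u : ℝ → EuclideanSpace ℝ (Fin 3) → EuclideanSpace ℝ (Fin 3),
      (∀ K : ℝ, 0 < K → ∀ t₀ < (1 : ℝ), ∃ t, t₀ < t ∧ t < 1 ∧
        ∃ (x₀ : EuclideanSpace ℝ (Fin 3)) (L V : ℝ)
          (Q : EuclideanSpace ℝ (Fin 3) ≃ₗᵢ[ℝ] EuclideanSpace ℝ (Fin 3))
          (W : EuclideanSpace ℝ (Fin 3) → EuclideanSpace ℝ (Fin 3)),
          0 < L ∧ 0 < V ∧ IsColumnar W ∧ (∀ x, ‖u t x‖ ≤ V) ∧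
          (∃ x₁, dist x₁ x₀ ≤ L ∧ V ≤ 2 * ‖u t x₁‖) ∧
          (∃ y y' : EuclideanSpace ℝ (Fin 3), ‖y‖ ≤ 1 ∧ ‖y'‖ ≤ 1 ∧ (4 : ℝ)⁻¹ ≤ ‖W y - W y'‖) ∧
          K * 1 ≤ L * V ∧
          (∀ y : EuclideanSpace ℝ (Fin 3), ‖y‖ ≤ K →
            ‖V⁻¹ • Q.symm (u t (x₀ + L • Q y)) - W y‖ ≤ K⁻¹) ∧
          (1 - t) * V ≤ K * L) ∧
      ¬ IsTypeIBlowup u 1 ∧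
      (¬ ∃ ρ M : ℝ, 0 < ρ ∧ ∀ s ∈ Ioo (1 - ρ ^ 2) 1, ∀ x ∈ ball (0 : EuclideanSpace ℝ (Fin 3)) ρ,
        ‖u s x‖ ≤ M) ∧
      (∀ xr : EuclideanSpace ℝ (Fin 3), xr ≠ 0 → ∃ ρ M : ℝ, 0 < ρ ∧ ∀ s ∈ Ioo (1 - ρ ^ 2) 1,
        ∀ x ∈ ball xr ρ, ‖u s x‖ ≤ M) ∧
      (∀ (K t : ℝ), 4 < K → 0 < t → t < 1 →
        ∀ (x₀ : EuclideanSpace ℝ (Fin 3)) (L V : ℝ)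
          (Q : EuclideanSpace ℝ (Fin 3) ≃ₗᵢ[ℝ] EuclideanSpace ℝ (Fin 3))
          (W : EuclideanSpace ℝ (Fin 3) → EuclideanSpace ℝ (Fin 3)),
          0 < L → 0 < V → IsColumnar W →
          (∃ x₁, dist x₁ x₀ ≤ L ∧ V ≤ 2 * ‖u t x₁‖) →
          (∀ y : EuclideanSpace ℝ (Fin 3), ‖y‖ ≤ K →
            ‖V⁻¹ • Q.symm (u t (x₀ + L • Q y)) - W y‖ ≤ K⁻¹) →
          K * L < 3 * Real.sqrt (Real.sqrt (1 - t)) ∧ K * L / 4 < dist 0 x₀) := by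
  -- profile, fourth root, wandering centre, family
  set G : EuclideanSpace ℝ (Fin 3) → EuclideanSpace ℝ (Fin 3) :=
    fun y => max 0 (1 - cylRadius y) • (eZ : EuclideanSpace ℝ (Fin 3)) with hG
  set σ : ℝ → ℝ := fun t => Real.sqrt (Real.sqrt (1 - t)) with hσ
  set c : ℝ → EuclideanSpace ℝ (Fin 3) := fun t => (3 * σ t) • EuclideanSpace.single 0 1 with hc
  set u : ℝ → EuclideanSpace ℝ (Fin 3) → EuclideanSpace ℝ (Fin 3) :=
    fun t x => if ‖x - c t‖ ≤ σ t then ((σ t)⁻¹ ^ 3) • G ((σ t ^ 2)⁻¹ • (x - c t)) else 0 with hu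
  have hGle : ∀ y, ‖G y‖ ≤ 1 := fun y => norm_coneProfile_le y
  have hG0 : G 0 = eZ := coneProfile_zero
  have hGcol : IsColumnar G := isColumnar_coneProfile
  have hσpos : ∀ t < (1 : ℝ), 0 < σ t := fun t ht => (sqrt_sqrt_pos_and_pow_four ht).1
  have hσ4 : ∀ t < (1 : ℝ), σ t ^ 4 = 1 - t := fun t ht => (sqrt_sqrt_pos_and_pow_four ht).2.2
  have hnc : ∀ t < (1 : ℝ), ‖c t‖ = 3 * σ t := by
    intro t ht
    simp only [hc, norm_smul, Real.norm_of_nonneg (by linarith [hσpos t ht] : (0:ℝ) ≤ 3 * σ t)]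
    simp
  -- value at the centre, global bound, support
  have huc : ∀ t < (1 : ℝ), u t (c t) = ((σ t)⁻¹ ^ 3) • (eZ : EuclideanSpace ℝ (Fin 3)) := by
    intro t ht
    have h : ‖c t - c t‖ ≤ σ t := by rw [sub_self, norm_zero]; exact (hσpos t ht).le
    simp only [hu, if_pos h, sub_self, smul_zero, hG0]
  have hnormc : ∀ t < (1 : ℝ), ‖u t (c t)‖ = (σ t)⁻¹ ^ 3 := by
    intro t ht
    rw [huc t ht, norm_smul, norm_eZ_l, mul_one, Real.norm_of_nonneg (by positivity [hσpos t ht])]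
  have hbound : ∀ t < (1 : ℝ), ∀ x, ‖u t x‖ ≤ (σ t)⁻¹ ^ 3 := by
    intro t ht x
    have hσ0 := hσpos t ht
    by_cases hx : ‖x - c t‖ ≤ σ t
    · simp only [hu, if_pos hx]
      rw [norm_smul, Real.norm_of_nonneg (by positivity)]
      exact mul_le_of_le_one_right (by positivity) (hGle _)
    · simp only [hu, if_neg hx, norm_zero]
      positivity
  have hsupp : ∀ t x, u t x ≠ 0 → dist x (c t) ≤ σ t := by
    intro t x hx
    rw [dist_eq_norm]
    by_contra h
    exact hx (by simp only [hu, if_neg h])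
  have hzero : ∀ t x, σ t < dist x (c t) → u t x = 0 := by
    intro t x hx
    by_contra h
    exact absurd (hsupp t x h) (not_le.2 hx)
  -- exact columnarity on the core ball
  have hcore : ∀ t < (1 : ℝ), ∀ (L : ℝ) (y : EuclideanSpace ℝ (Fin 3)), 0 ≤ L → L * ‖y‖ ≤ σ t →
      u t (c t + L • (LinearIsometryEquiv.refl ℝ _ y)) = ((σ t)⁻¹ ^ 3) • G (((σ t ^ 2)⁻¹ * L) • y) := by
    intro t ht L y hL hy
    have hn : ‖c t + L • y - c t‖ ≤ σ t := by
      rw [add_sub_cancel_left, norm_smul, Real.norm_of_nonneg hL]; exact hy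
    simp only [LinearIsometryEquiv.coe_refl, id_eq]
    simp only [hu, if_pos hn, add_sub_cancel_left, smul_smul]
  refine ⟨u, ?_, ?_, ?_, ?_, ?_⟩
  · -- (i) LATE columnar witnesses at every level frequently before `1`
    intro K hK t₀ ht₀
    set κ : ℝ := max K 1 with hκ
    have hκ1 : 1 ≤ κ := le_max_right _ _
    have hκK : K ≤ κ := le_max_left _ _
    have hκ0 : 0 < κ := one_pos.trans_le hκ1
    set t : ℝ := (max (max t₀ 0) (1 - (κ ^ 4)⁻¹) + 1) / 2 with ht
    have hκ4 : 0 < (κ ^ 4)⁻¹ := by positivity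
    have hmax_lt : max (max t₀ 0) (1 - (κ ^ 4)⁻¹) < 1 := max_lt (max_lt ht₀ one_pos) (by linarith)
    have ht₀t : t₀ < t := by
      have := (le_max_left t₀ 0).trans (le_max_left (max t₀ 0) (1 - (κ ^ 4)⁻¹)); rw [ht]; linarith
    have ht0 : 0 < t := by
      have := (le_max_right t₀ 0).trans (le_max_left (max t₀ 0) (1 - (κ ^ 4)⁻¹)); rw [ht]; linarith
    have ht1 : t < 1 := by rw [ht]; linarith
    have hs : 0 < 1 - t := sub_pos.2 ht1
    have hsκ : 1 - t ≤ (κ ^ 4)⁻¹ := by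
      have := le_max_right (max t₀ 0) (1 - (κ ^ 4)⁻¹); rw [ht]; linarith
    have hσ0 := hσpos t ht1
    -- `σ t ≤ κ⁻¹`
    have hσκ : σ t ≤ κ⁻¹ := by
      have h1 : σ t ^ 4 ≤ (κ⁻¹) ^ 4 := by rw [hσ4 t ht1, inv_pow]; exact hsκ
      exact (pow_le_pow_iff_left₀ hσ0.le (by positivity) (by norm_num)).1 h1
    have hσK : σ t * K ≤ 1 := by
      calc σ t * K ≤ κ⁻¹ * κ := mul_le_mul hσκ hκK hK.le (by positivity)
        _ = 1 := inv_mul_cancel₀ hκ0.ne'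
    -- the witness: centre `c t`, core length `σ/K`, speed `σ⁻³`, profile `G((σK)⁻¹ ·)`
    set L : ℝ := σ t / K with hL
    have hL0 : 0 < L := by positivity
    have hKL : K * L = σ t := by rw [hL]; field_simp
    set W : EuclideanSpace ℝ (Fin 3) → EuclideanSpace ℝ (Fin 3) := fun y => G ((σ t * K)⁻¹ • y) with hW
    have hWcol : IsColumnar W := by
      intro y τ
      simp only [hW, smul_add, smul_smul]
      rw [show ((σ t * K)⁻¹ * τ) • (eZ : EuclideanSpace ℝ (Fin 3)) = ((σ t * K)⁻¹ * τ) • eZ from rfl]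
      exact hGcol _ _
    have hW0 : W 0 = eZ := by simp only [hW, smul_zero, hG0]
    refine ⟨t, ht₀t, ht1, c t, L, (σ t)⁻¹ ^ 3, LinearIsometryEquiv.refl ℝ _, W, hL0, by positivity, hWcol,
      hbound t ht1, ?_, ?_, ?_, ?_, ?_⟩
    · refine ⟨c t, by rw [dist_self]; exact hL0.le, ?_⟩
      rw [hnormc t ht1]; linarith [pow_pos (inv_pos.2 hσ0) 3]
    · -- oscillation: `W 0 = e_z`, `‖W e_x‖ ≤ 1 - 1/(σK)… ` in fact `W e_x = max(0, 1 - (σK)⁻¹) e_z` with `(σK)⁻¹ ≥ 1`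
      refine ⟨0, EuclideanSpace.single 0 1, by simp, by simp, ?_⟩
      have hcyl : cylRadius ((σ t * K)⁻¹ • EuclideanSpace.single (0 : Fin 3) (1 : ℝ)) = (σ t * K)⁻¹ := by
        rw [cylRadius_smul, abs_of_pos (by positivity)]
        have : cylRadius (EuclideanSpace.single (0 : Fin 3) (1 : ℝ)) = 1 := by simp [cylRadius]
        rw [this, mul_one]
      have hW1 : W (EuclideanSpace.single 0 1) = 0 := by
        simp only [hW, hG]
        rw [hcyl, max_eq_left (by
          have : 1 ≤ (σ t * K)⁻¹ := one_le_inv_iff₀.2 ⟨by positivity, hσK⟩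
          linarith), zero_smul]
      rw [hW0, hW1, sub_zero, norm_eZ_l]
      norm_num
    · -- Reynolds: `K ≤ (σ/K) σ⁻³`, i.e. `σ² K² ≤ 1`
      rw [mul_one, hL]
      have h1 : σ t / K * (σ t)⁻¹ ^ 3 = 1 / (K * σ t ^ 2) := by field_simp
      rw [h1, le_div_iff₀ (by positivity)]
      calc K * (K * σ t ^ 2) = (σ t * K) ^ 2 := by ring
        _ ≤ 1 := pow_le_one₀ (by positivity) hσK
    · -- closeness: exact
      intro y hy
      have hrefl : ∀ z : EuclideanSpace ℝ (Fin 3),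
          (LinearIsometryEquiv.refl ℝ (EuclideanSpace ℝ (Fin 3))).symm z = z := fun z => rfl
      have hy' : L * ‖y‖ ≤ σ t := by
        calc L * ‖y‖ ≤ L * K := mul_le_mul_of_nonneg_left hy hL0.le
          _ = σ t := by rw [mul_comm, hKL]
      rw [hcore t ht1 L y hL0.le hy', hrefl, smul_smul,
        inv_mul_cancel₀ (by positivity : (σ t)⁻¹ ^ 3 ≠ 0), one_smul]
      have harg : (σ t ^ 2)⁻¹ * L = (σ t * K)⁻¹ := by rw [hL]; field_simp
      rw [harg]
      change ‖W y - W y‖ ≤ K⁻¹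
      rw [sub_self, norm_zero]; positivity
    · -- late: `(1-t) σ⁻³ = σ = K L`
      rw [hKL, ← hσ4 t ht1]
      have : σ t ^ 4 * (σ t)⁻¹ ^ 3 = σ t := by field_simp
      rw [this]
  · -- (ii) faster than the Type-I rate at the centres
    rintro ⟨C, hC⟩
    obtain ⟨l, hl1, hsub⟩ := mem_nhdsLT_iff_exists_Ioo_subset.1 hC
    rw [mem_Iio] at hl1
    -- time `1 - a⁴` with `a` small
    set a : ℝ := min (min 2⁻¹ ((1 - l) / 2)) (|C| + 2)⁻¹ with ha_def
    have hC2 : 0 < |C| + 2 := by positivity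
    have ha0 : 0 < a := lt_min (lt_min (by norm_num) (by linarith)) (inv_pos.2 hC2)
    have ha1 : a ≤ 2⁻¹ := (min_le_left _ _).trans (min_le_left _ _)
    have ha2 : a ≤ (1 - l) / 2 := (min_le_left _ _).trans (min_le_right _ _)
    have ha3 : a ≤ (|C| + 2)⁻¹ := min_le_right _ _
    have ha4 : a ^ 4 ≤ a := by
      have : a ^ 4 ≤ a ^ 1 := pow_le_pow_of_le_one ha0.le (by linarith) (by norm_num)
      rwa [pow_one] at this
    have hmem : 1 - a ^ 4 ∈ Ioo l 1 := ⟨by linarith, by linarith [pow_pos ha0 4]⟩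
    have hσa : σ (1 - a ^ 4) = a := sqrt_sqrt_one_sub a ha0.le
    have h : ‖u (1 - a ^ 4) (c (1 - a ^ 4))‖ ≤ C / Real.sqrt (1 - (1 - a ^ 4)) := hsub hmem (c (1 - a ^ 4))
    rw [hnormc (1 - a ^ 4) (by linarith [pow_pos ha0 4]), hσa, sub_sub_cancel,
      show a ^ 4 = (a ^ 2) ^ 2 by ring, Real.sqrt_sq (sq_nonneg a)] at h
    -- `a⁻³ ≤ C / a²`, i.e. `a⁻¹ ≤ C`, against `a⁻¹ ≥ |C| + 2`
    have h2 : a⁻¹ ≤ C := by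
      have h3 : a⁻¹ ^ 3 * a ^ 2 ≤ C := by
        have := mul_le_mul_of_nonneg_right h (sq_nonneg a)
        rwa [div_mul_cancel₀ _ (by positivity : a ^ 2 ≠ 0)] at this
      have h4 : a⁻¹ ^ 3 * a ^ 2 = a⁻¹ := by field_simp
      rwa [h4] at h3
    have h5 : |C| + 2 ≤ a⁻¹ := by rw [le_inv_comm₀ hC2 ha0]; exact ha3
    linarith [le_abs_self C]
  · -- (iii) the origin is singular
    rintro ⟨ρ, M, hρ, hbd⟩
    set a : ℝ := min (min (ρ / 4) 2⁻¹) (|M| + 2)⁻¹ with ha_def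
    have hM2 : 0 < |M| + 2 := by positivity
    have ha0 : 0 < a := lt_min (lt_min (by positivity) (by norm_num)) (inv_pos.2 hM2)
    have ha1 : a ≤ ρ / 4 := (min_le_left _ _).trans (min_le_left _ _)
    have ha2 : a ≤ 2⁻¹ := (min_le_left _ _).trans (min_le_right _ _)
    have ha3 : a ≤ (|M| + 2)⁻¹ := min_le_right _ _
    have ha4 : a ^ 4 < ρ ^ 2 := by
      have h1 : a ^ 2 ≤ (ρ / 4) ^ 2 := pow_le_pow_left₀ ha0.le ha1 2
      have h2 : a ^ 2 ≤ 4⁻¹ := by nlinarith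
      nlinarith [pow_pos hρ 2]
    have hmem : 1 - a ^ 4 ∈ Ioo (1 - ρ ^ 2) 1 := ⟨by linarith, by linarith [pow_pos ha0 4]⟩
    have hσa : σ (1 - a ^ 4) = a := sqrt_sqrt_one_sub a ha0.le
    have hlt1 : 1 - a ^ 4 < 1 := by linarith [pow_pos ha0 4]
    have hcmem : c (1 - a ^ 4) ∈ ball (0 : EuclideanSpace ℝ (Fin 3)) ρ := by
      rw [mem_ball, dist_zero_right, hnc _ hlt1, hσa]
      linarith
    have h := hbd (1 - a ^ 4) hmem (c (1 - a ^ 4)) hcmem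
    rw [hnormc _ hlt1, hσa] at h
    have h4 : |M| + 2 ≤ a⁻¹ := by rw [le_inv_comm₀ hM2 ha0]; exact ha3
    have h5 : a⁻¹ ≤ a⁻¹ ^ 3 := by
      have h6 : (1 : ℝ) ≤ a⁻¹ := one_le_inv_iff₀.2 ⟨ha0, by linarith⟩
      calc a⁻¹ = a⁻¹ ^ 1 := (pow_one _).symm
        _ ≤ a⁻¹ ^ 3 := pow_le_pow_right₀ h6 (by norm_num)
    linarith [le_abs_self M]
  · -- (iii') every other point is regular
    intro xr hxr
    have hxr0 : 0 < ‖xr‖ := norm_pos_iff.2 hxr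
    refine ⟨‖xr‖ / 4, (3 * ‖xr‖ / 16)⁻¹ ^ 3, by positivity, fun s' hs' x hx => ?_⟩
    have hs'1 : s' < 1 := hs'.2
    have hσ0 := hσpos s' hs'1
    by_cases hσx : σ s' < 3 * ‖xr‖ / 16
    · have hfar : σ s' < dist x (c s') := by
        rw [mem_ball] at hx
        have h3 : ‖xr‖ ≤ dist xr (c s') + ‖c s'‖ := by
          rw [dist_eq_norm]
          calc ‖xr‖ = ‖(xr - c s') + c s'‖ := by rw [sub_add_cancel]
            _ ≤ ‖xr - c s'‖ + ‖c s'‖ := norm_add_le _ _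
        have h2 : dist xr (c s') ≤ dist xr x + dist x (c s') := dist_triangle _ _ _
        rw [dist_comm xr x] at h2
        rw [hnc s' hs'1] at h3
        linarith
      rw [hzero s' x hfar, norm_zero]
      positivity
    · push Not at hσx
      refine (hbound s' hs'1 x).trans ?_
      exact pow_le_pow_left₀ (by positivity) (inv_anti₀ (by positivity) hσx) 3
  · -- (iv) no floor, never anchored at the singular point
    intro K t hK ht0 ht1 x₀ L V Q W hL hV hW hnear hclose
    have hσ0 := hσpos t ht1
    have hLK : L * (K - 1) ≤ 2 * σ t :=
      mul_sub_one_le_of_support (hsupp t) hK hL hV hW hnear hclose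
    have hKL : K * L < 3 * σ t :=
      coreRadius_lt_of_support (hsupp t) hK hL hV hW hnear hclose
    refine ⟨hKL, ?_⟩
    obtain ⟨x₁, hx₁, hVx₁⟩ := hnear
    have hfx₁ : u t x₁ ≠ 0 := by
      intro h
      rw [h, norm_zero, mul_zero] at hVx₁
      exact absurd hVx₁ (not_le.2 hV)
    have hx₁c : dist x₁ (c t) ≤ σ t := hsupp t x₁ hfx₁
    have hL9 : L < 2 * σ t / 3 := by
      rw [lt_div_iff₀ (by norm_num : (0:ℝ) < 3)]
      nlinarith [mul_lt_mul_of_pos_left (show (3:ℝ) < K - 1 by linarith) hL]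
    have htri : 3 * σ t ≤ dist 0 x₀ + L + σ t := by
      have h3 : dist (0 : EuclideanSpace ℝ (Fin 3)) (c t) = 3 * σ t := by
        rw [dist_comm, dist_zero_right, hnc t ht1]
      have h4 := dist_triangle (0 : EuclideanSpace ℝ (Fin 3)) x₀ (c t)
      have h5 := dist_triangle x₀ x₁ (c t)
      rw [dist_comm x₀ x₁] at h5
      linarith
    linarith

end CoreExclusionAnchorObstruction

end Summit.NavierStokesRegularity.NavierStokesRegularity.Theorems

end
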